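import Literature.AlgebraicGeometry.HodgeTheory.ComplexConjugation
import Mathlib.LinearAlgebra.Matrix.BilinearForm
import Mathlib.LinearAlgebra.BilinearForm.Orthogonal
import Mathlib.LinearAlgebra.LinearIndependent.BaseChange
import Mathlib.LinearAlgebra.FiniteDimensional.Lemmas
import Mathlib.LinearAlgebra.Eigenspace.Basic
import Mathlib.LinearAlgebra.Matrix.ToLin
import Mathlib.Analysis.Complex.Basic
import Mathlib.Topology.Algebra.Order.Archimedean
import Mathlib.Topology.Instances.Rat
import HarnessLib

/-!
# The signature `(n, n)` of the Hermitian form of a polarized abelian variety of Weil type — linear algebra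

Layer `Literature/AlgebraicGeometry/Motives`, companion of `Motives/HyperbolicWeilType`,
`Motives/RationalDegreeOneModel` and `Motives/WeilFormIsotropicBlockVectors(All)`. B. van Geemen,
*An introduction to the Hodge conjecture for abelian varieties*, LNM 1594 (1994), Lemma 5.2 (2), (4),
(5): for `(X, K, E)` a polarized abelian variety of Weil type, `K = ℚ(√-d)`, the form
`H(x, y) = E(x, (√-d)^* y) + √-d E(x, y)` is `K`-Hermitian (2), has signature `(n, n)` (4) — the proof
uses the second Riemann condition `E(x, Jx) > 0`, i.e. Hodge–Riemann in degree one — and `H¹(X, ℚ)`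
contains `K`-stable `ℚ`-subspaces `W±` of dimension `2n` on which `H` is positive, resp. negative
definite (5). This file is the LINEAR ALGEBRA of that proof, in the coordinates of a rational degree-one
model `(u, M_A, ω, G_A)` of `(A, φ, h)` (`M_A` the rational matrix of `φ^*` on `H¹(A(ℂ); ℂ)`,
`M_A² = -d`; `G_A` the rational Gram matrix of the polarization pairing `Q_h = h^{2n-1} ⌣ (· ⌣ ·)`,
alternating and of Weil type `M_Aᵀ G_A M_A = d G_A`), so that `S(x, y) = x ⬝ G_A (M_A y)` is the
symmetric rational form whose signature is at stake and `Re (z ⬝ G_A M_A z̄)` is van Geemen's `H` up to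
the factor `√d`:

* part I (over `ℚ ⊂ ℝ ⊂ ℂ`, coordinate vectors): `S` is symmetric, `M_A` is a similitude,
  `S(a x + b M_A x) = (a² + d b²) S(x)` (`weilSig_isSymm`, `…_mulVec_mulVec`, `…_line`); the density
  step `weilSig_exists_mem_pos` (a rational `W` and a complex `Z` with `Re (z ⬝ C z̄) > 0` on `Z ∖ 0`
  and `dim_ℚ W + dim_ℂ Z > |ι|` give `v ∈ W` with `v ⬝ C v > 0`); van Geemen's inductive construction
  `weilSig_exists_stable_posDef` of an `M_A`-stable rational `2n`-dimensional `S`-positive subspace one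
  `K`-line at a time, and both signs `weilSig_exists_PN` — in the exact shape `hPN` consumed by
  `Motives.exists_isotropic_blockVectors'`;
* part II (coordinates): an endomorphism / a bilinear map with rational matrix / Gram matrix in a
  basis acts on coordinates by that matrix (`weilSig_equivFun_map`, `weilSig_pairing_eq`,
  `weilSig_matrix_sq`), and complex conjugation `conjClass` of `Hᵏ(Y; ℂ)` is coordinatewise in a basis
  of RATIONAL classes (`weilSig_equivFun_conjClass`; rational classes are real, Voisin I Cor. 6.12);
* part III (complex linear algebra on an abstract `V` with coordinates `β`, `T = φ^*`, `Q`, and a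
  coordinatewise conjugation `κ`): from Hodge–Riemann in the form "`i Q(x, κ x) ∈ ℝ_{>0}·ρ ω` on
  `H^{1,0} ∖ 0`" the form `Re H` is definite of opposite signs on
  `Z₁ = (V_s ∩ H^{1,0}) ⊕ (V_{-s} ∩ H^{0,1})` and `Z₂ = (V_{-s} ∩ H^{1,0}) ⊕ (V_s ∩ H^{0,1})`
  (`s = i√d`; Weil type makes `V_{±s}` isotropic, conjugation swaps the pieces), each of dimension
  `≥ 2n` when the `K`-multiplicities are `(n, n)` (`weilSig_piece`, `weilSig_piece_finrank`,
  `weilSig_exists_Zp_Zn`).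

Provenance: first landed on the summit side for `d = 7` (route `HeckePrymWeil` of the Hodge summit,
files `Theorems/HeckePrymWeilWeilTwelvefoldsSqrtMinus7WeilSignature{Lemmas,Coordinates,Hermitian}`,
same statements and proofs); re-hosted here for every `d > 0` because the consumers are Literature
facts (`Motives.exists_cmWeilSurface_aimedSplitProduct_of_ne_one_of_ne_three`,
`HodgeTheory.exists_weilTypeSurface_prod_isHyperbolicWeilType_all`), whose discharges cannot import
`Summits` (CONVENTIONS §2). Everything is proved; no definition and no named fact is introduced.

## References

* [vanGeemen1994HodgeAV] B. van Geemen, An introduction to the Hodge conjecture for abelian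
  varieties, LNM 1594 (1994), Lemma 5.2 (2), (4), (5) and their proofs.
* [VoisinHodgeI2002] C. Voisin, Hodge Theory and Complex Algebraic Geometry I (2002), §6.1.3 Cor. 6.12.
-/

noncomputable section

open Complex
open scoped Matrix ComplexConjugate
open Literature.AlgebraicGeometry.HodgeTheory Literature.AlgebraicTopology.SingularHomology

universe u

namespace Literature.AlgebraicGeometry.Motives

/-! ## Part I: rational linear algebra -/

/-! ### Bilinear bookkeeping -/

/-- Expanding a bilinear map on two finite combinations of a family:
`B (Σ aᵢ uᵢ) (Σ cⱼ uⱼ) = Σᵢ Σⱼ (aᵢ cⱼ) • B uᵢ uⱼ` (any commutative semiring). [folklore] -/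
theorem weilSig_bilin_sum_sum {R V W κ : Type*} [CommSemiring R] [AddCommMonoid V] [Module R V]
    [AddCommMonoid W] [Module R W] [Fintype κ] (B : V →ₗ[R] V →ₗ[R] W) (a c : κ → R) (u : κ → V) :
    B (∑ i, a i • u i) (∑ j, c j • u j) = ∑ i, ∑ j, (a i * c j) • B (u i) (u j) := by
  have h1 : ∀ j, B (∑ i, a i • u i) (c j • u j) = ∑ i, (a i * c j) • B (u i) (u j) := by
    intro j
    rw [LinearMap.map_smul, map_sum, LinearMap.sum_apply, Finset.smul_sum]
    refine Finset.sum_congr rfl fun i _ => ?_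
    rw [LinearMap.map_smul, LinearMap.smul_apply, smul_smul, mul_comm]
  rw [map_sum]
  simp_rw [h1]
  rw [Finset.sum_comm]

section Rational

variable {ι : Type*} [Fintype ι] [DecidableEq ι]

/-! ### The density step -/

/-- **Density step.** For a rational matrix `C`, a rational subspace `W ⊆ ℚ^ι` and a complex subspace
`Z ⊆ ℂ^ι` with `Re (z ⬝ C z̄) > 0` on `Z ∖ 0` and `dim_ℚ W + dim_ℂ Z > |ι|`, some `v ∈ W` has `v ⬝ C v > 0`:
a `ℚ`-basis `(wₖ)` of `W` is `ℂ`-independent, so its complex span meets `Z` in some `z = Σ cₖ wₖ ≠ 0`; with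
`F(r) = Σₖₗ rₖ rₗ (wₖ ⬝ C wₗ)`, `Re (z ⬝ C z̄) = F(Re c) + F(Im c) > 0`, so `F > 0` at a real, hence (continuity,
density) at a rational point `q`, and `v = Σ qₖ wₖ`. [cite: vanGeemen1994HodgeAV, proof of Lemma 5.2 (5)] -/
theorem weilSig_exists_mem_pos (C : Matrix ι ι ℚ) (W : Submodule ℚ (ι → ℚ))
    (Z : Submodule ℂ (ι → ℂ)) (hdim : Fintype.card ι < Module.finrank ℚ W + Module.finrank ℂ Z)
    (hpos : ∀ z ∈ Z, z ≠ 0 → 0 < (z ⬝ᵥ C.map (algebraMap ℚ ℂ) *ᵥ star z).re) :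
    ∃ v ∈ W, 0 < v ⬝ᵥ C *ᵥ v := by
  classical
  set m := Module.finrank ℚ W with hm
  let bW := Module.finBasis ℚ W
  let w : Fin m → ι → ℚ := fun k => (bW k : ι → ℚ)
  have hw : LinearIndependent ℚ w :=
    bW.linearIndependent.map' W.subtype (Submodule.ker_subtype W)
  let wc : Fin m → ι → ℂ := fun k => algebraMap ℚ ℂ ∘ w k
  have hwc : LinearIndependent ℂ wc := linearIndependent_algebraMap_comp_iff.2 hw
  set Wc : Submodule ℂ (ι → ℂ) := Submodule.span ℂ (Set.range wc) with hWc_def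
  have hWc : Module.finrank ℂ Wc = m := by
    rw [hWc_def, finrank_span_eq_card hwc, Fintype.card_fin]
  obtain ⟨z, hzW, hzZ, hz0⟩ : ∃ z, z ∈ Wc ∧ z ∈ Z ∧ z ≠ 0 := by
    by_contra hcon
    have hdis : Disjoint Wc Z := by
      rw [Submodule.disjoint_def]
      intro z hzW hzZ
      by_contra hz0
      exact hcon ⟨z, hzW, hzZ, hz0⟩
    have h := Submodule.finrank_add_finrank_le_of_disjoint hdis
    rw [hWc, Module.finrank_fintype_fun_eq_card] at h
    omega
  obtain ⟨c, rfl⟩ := (Submodule.mem_span_range_iff_exists_fun ℂ).1 hzW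
  let q : Fin m → Fin m → ℚ := fun k l => w k ⬝ᵥ C *ᵥ w l
  let F : (Fin m → ℝ) → ℝ := fun r => ∑ k, ∑ l, r k * r l * (q k l : ℝ)
  have hF : Continuous F :=
    continuous_finsetSum _ fun k _ => continuous_finsetSum _ fun l _ =>
      ((continuous_apply k).mul (continuous_apply l)).mul continuous_const
  -- `Re (z ⬝ C z̄) = F(Re c) + F(Im c)`
  have hstar : star (∑ k, c k • wc k) = ∑ k, (starRingEnd ℂ) (c k) • wc k := by
    rw [star_sum]
    refine Finset.sum_congr rfl fun k _ => ?_
    rw [star_smul]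
    congr 1
    funext i
    exact map_ratCast (starRingEnd ℂ) (w k i)
  have hpair : ∀ k l, wc k ⬝ᵥ C.map (algebraMap ℚ ℂ) *ᵥ wc l = ((q k l : ℚ) : ℂ) := fun k l => by
    rw [show C.map (algebraMap ℚ ℂ) *ᵥ wc l = algebraMap ℚ ℂ ∘ (C *ᵥ w l) from
      funext fun i => (RingHom.map_mulVec (algebraMap ℚ ℂ) C (w l) i).symm, ← RingHom.map_dotProduct]
    rfl
  have hexp : (∑ k, c k • wc k) ⬝ᵥ C.map (algebraMap ℚ ℂ) *ᵥ star (∑ k, c k • wc k) =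
      ∑ k, ∑ l, (c k * (starRingEnd ℂ) (c l)) * ((q k l : ℚ) : ℂ) := by
    rw [hstar, ← Matrix.toBilin'_apply', weilSig_bilin_sum_sum]
    refine Finset.sum_congr rfl fun k _ => Finset.sum_congr rfl fun l _ => ?_
    rw [Matrix.toBilin'_apply', hpair, smul_eq_mul]
  have hre : ((∑ k, c k • wc k) ⬝ᵥ C.map (algebraMap ℚ ℂ) *ᵥ star (∑ k, c k • wc k)).re =
      F (fun k => (c k).re) + F (fun k => (c k).im) := by
    rw [hexp, Complex.re_sum]
    simp only [Complex.re_sum, Complex.mul_re, Complex.mul_im, Complex.conj_re, Complex.conj_im,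
      Complex.ratCast_re, Complex.ratCast_im, mul_zero, sub_zero, F]
    rw [← Finset.sum_add_distrib]
    refine Finset.sum_congr rfl fun k _ => ?_
    rw [← Finset.sum_add_distrib]
    refine Finset.sum_congr rfl fun l _ => ?_
    ring
  obtain ⟨r, hr⟩ : ∃ r, 0 < F r := by
    by_contra hno
    push Not at hno
    linarith [hno (fun k => (c k).re), hno (fun k => (c k).im), (hre ▸ hpos _ hzZ hz0 :)]
  obtain ⟨qv, hqv⟩ := (DenseRange.piMap fun _ : Fin m => Rat.denseRange_cast (𝕜 := ℝ)).exists_mem_open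
    (isOpen_lt continuous_const hF) ⟨r, hr⟩
  refine ⟨∑ k, qv k • w k, Submodule.sum_mem _ fun k _ => Submodule.smul_mem _ _ (bW k).2, ?_⟩
  have hval : (((∑ k, qv k • w k) ⬝ᵥ C *ᵥ (∑ k, qv k • w k) : ℚ) : ℝ) =
      F (Pi.map (fun _ : Fin m => ((↑) : ℚ → ℝ)) qv) := by
    rw [← Matrix.toBilin'_apply', weilSig_bilin_sum_sum]
    simp only [Matrix.toBilin'_apply', smul_eq_mul, Rat.cast_sum, Rat.cast_mul, F, q, Pi.map_apply]
  have h : (0 : ℝ) < ((∑ k, qv k • w k) ⬝ᵥ C *ᵥ (∑ k, qv k • w k) : ℚ) := by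
    rw [hval]
    exact hqv
  exact_mod_cast h

/-! ### The symmetric rational form `S(x, y) = x ⬝ G_A (M_A y)` of a Weil pair -/

section WeilPair

variable {d : ℚ} {MA GA : Matrix ι ι ℚ}

/-- `M_Aᵀ G_A = -G_A M_A` (from `M_A² = -d`, `M_Aᵀ G_A M_A = d G_A`, `d ≠ 0`). [folklore] -/
theorem weilSig_transpose_mul (hd : d ≠ 0) (hMA : MA * MA = (-d) • (1 : Matrix ι ι ℚ))
    (hWt : MAᵀ * GA * MA = d • GA) : MAᵀ * GA = -(GA * MA) := by
  have h : MAᵀ * GA * MA * MA = d • (GA * MA) := by rw [hWt, Matrix.smul_mul]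
  rw [Matrix.mul_assoc, hMA, Matrix.mul_smul, Matrix.mul_one] at h
  have h2 : d • (MAᵀ * GA + GA * MA) = 0 := by
    rw [smul_add, ← h, neg_smul, add_neg_cancel]
  rcases smul_eq_zero.1 h2 with h3 | h3
  · exact absurd h3 hd
  · exact eq_neg_of_add_eq_zero_left h3

/-- **`S` is symmetric**: `(G_A M_A)ᵀ = G_A M_A` for `G_A` alternating of Weil type.
[cite: vanGeemen1994HodgeAV, Lemma 5.2 (2)] -/
theorem weilSig_isSymm (hd : d ≠ 0) (hMA : MA * MA = (-d) • (1 : Matrix ι ι ℚ)) (hGA : GAᵀ = -GA)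
    (hWt : MAᵀ * GA * MA = d • GA) : (GA * MA).IsSymm := by
  change (GA * MA)ᵀ = GA * MA
  rw [Matrix.transpose_mul, hGA, Matrix.mul_neg, weilSig_transpose_mul hd hMA hWt, neg_neg]

/-- `S(x, y) = x ⬝ G_A (M_A y)` is the bilinear form of the matrix `G_A M_A`. [folklore] -/
theorem weilSig_apply (x y : ι → ℚ) : Matrix.toBilin' (GA * MA) x y = x ⬝ᵥ GA *ᵥ (MA *ᵥ y) := by
  rw [Matrix.toBilin'_apply', Matrix.mulVec_mulVec]

/-- `S(x, y) = S(y, x)`. [cite: vanGeemen1994HodgeAV, Lemma 5.2 (2)] -/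
theorem weilSig_comm (hd : d ≠ 0) (hMA : MA * MA = (-d) • (1 : Matrix ι ι ℚ)) (hGA : GAᵀ = -GA)
    (hWt : MAᵀ * GA * MA = d • GA) (x y : ι → ℚ) :
    x ⬝ᵥ GA *ᵥ (MA *ᵥ y) = y ⬝ᵥ GA *ᵥ (MA *ᵥ x) := by
  rw [← weilSig_apply, ← weilSig_apply]
  exact (Matrix.isSymm_toBilin'_iff_isSymm.2 (weilSig_isSymm hd hMA hGA hWt)).eq x y

/-- **`M_A` is a similitude of `S`**: `S(M_A x, M_A y) = d · S(x, y)`. [cite: vanGeemen1994HodgeAV, Lemma 5.2 (2)] -/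
theorem weilSig_mulVec_mulVec (hWt : MAᵀ * GA * MA = d • GA) (x y : ι → ℚ) :
    MA *ᵥ x ⬝ᵥ GA *ᵥ (MA *ᵥ (MA *ᵥ y)) = d * (x ⬝ᵥ GA *ᵥ (MA *ᵥ y)) := by
  have h := Matrix.toBilin'_comp (GA * MA) MA MA
  rw [show MAᵀ * (GA * MA) * MA = d • (GA * MA) by rw [← Matrix.mul_assoc, hWt, Matrix.smul_mul],
    map_smul] at h
  have h' := congrArg (fun B : LinearMap.BilinForm ℚ (ι → ℚ) => B x y) h
  simp only [LinearMap.BilinForm.comp_apply, Matrix.toLin'_apply, LinearMap.smul_apply,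
    smul_eq_mul] at h'
  rw [weilSig_apply, weilSig_apply] at h'
  exact h'

/-- `S(x, M_A x) = 0` (`= -d · x ⬝ G_A x`, and `x ⬝ G_A x = 0` as `G_A` is alternating).
[cite: vanGeemen1994HodgeAV, Lemma 5.2 (2)] -/
theorem weilSig_self_mulVec (hMA : MA * MA = (-d) • (1 : Matrix ι ι ℚ)) (hGA : GAᵀ = -GA)
    (x : ι → ℚ) : x ⬝ᵥ GA *ᵥ (MA *ᵥ (MA *ᵥ x)) = 0 := by
  have h : x ⬝ᵥ GA *ᵥ x = -(x ⬝ᵥ GA *ᵥ x) := by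
    conv_lhs => rw [Matrix.dotProduct_mulVec, ← Matrix.mulVec_transpose, hGA, Matrix.neg_mulVec,
      neg_dotProduct, dotProduct_comm]
  rw [Matrix.mulVec_mulVec x MA MA, hMA, Matrix.smul_mulVec, Matrix.one_mulVec, Matrix.mulVec_smul,
    dotProduct_smul, show x ⬝ᵥ GA *ᵥ x = 0 by linarith, smul_zero]

/-- `S(a x + b M_A x, a x + b M_A x) = (a² + d b²) S(x, x)`: a `K`-line `ℚ x + ℚ M_A x` is
`S`-definite of the sign of `S(x, x)`. [cite: vanGeemen1994HodgeAV, proof of Lemma 5.2 (5)] -/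
theorem weilSig_line (hd : d ≠ 0) (hMA : MA * MA = (-d) • (1 : Matrix ι ι ℚ)) (hGA : GAᵀ = -GA)
    (hWt : MAᵀ * GA * MA = d • GA) (x : ι → ℚ) (a b : ℚ) :
    (a • x + b • MA *ᵥ x) ⬝ᵥ GA *ᵥ (MA *ᵥ (a • x + b • MA *ᵥ x)) =
      (a ^ 2 + d * b ^ 2) * (x ⬝ᵥ GA *ᵥ (MA *ᵥ x)) := by
  have h1 := weilSig_self_mulVec hMA hGA x
  have h2 : MA *ᵥ x ⬝ᵥ GA *ᵥ (MA *ᵥ x) = 0 := by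
    rw [← weilSig_comm hd hMA hGA hWt, h1]
  have h3 := weilSig_mulVec_mulVec hWt x x
  simp only [Matrix.mulVec_add, Matrix.mulVec_smul, dotProduct_add, dotProduct_smul, add_dotProduct,
    smul_dotProduct, smul_eq_mul, h1, h2, h3]
  ring

/-! ### The inductive construction of a definite `M_A`-stable rational subspace -/

/-- **A positive definite `M_A`-stable rational subspace of dimension `2n`** (van Geemen 1994, proof of
Lemma 5.2 (5), in coordinates): for `d > 0`, `M_A² = -d`, `G_A` alternating with `M_Aᵀ G_A M_A = d G_A`,
and a complex subspace `Z ⊆ ℂ^ι`, `dim Z ≥ 2n`, with `Re (z ⬝ G_A M_A z̄) > 0` on `Z ∖ 0`, there is an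
`M_A`-stable `ℚ`-subspace `P ⊆ ℚ^ι` of dimension `2n` with `x ⬝ G_A (M_A x) > 0` on `P ∖ 0`. Induction on
`j ≤ n`: the `S`-orthogonal `W` of `P_j` (`dim P_j = 2j`) has `dim W ≥ |ι| - 2j`, the density step gives
`v ∈ W` with `S(v, v) > 0`, `W` is `M_A`-stable, `v, M_A v` are independent (`c² = -d` has no rational root),
and `P_{j+1} = P_j ⊕ (ℚ v + ℚ M_A v)` is positive definite (`S(a v + b M_A v) = (a² + d b²) S(v)`).
[cite: vanGeemen1994HodgeAV, Lemma 5.2 (4)–(5)] -/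
theorem weilSig_exists_stable_posDef (hd : 0 < d) (hMA : MA * MA = (-d) • (1 : Matrix ι ι ℚ))
    (hGA : GAᵀ = -GA) (hWt : MAᵀ * GA * MA = d • GA) (n : ℕ) (Z : Submodule ℂ (ι → ℂ))
    (hZ : 2 * n ≤ Module.finrank ℂ Z)
    (hpos : ∀ z ∈ Z, z ≠ 0 → 0 < (z ⬝ᵥ (GA * MA).map (algebraMap ℚ ℂ) *ᵥ star z).re) :
    ∃ P : Submodule ℚ (ι → ℚ), (∀ v ∈ P, MA *ᵥ v ∈ P) ∧ Module.finrank ℚ P = 2 * n ∧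
      ∀ x ∈ P, x ≠ 0 → 0 < x ⬝ᵥ GA *ᵥ (MA *ᵥ x) := by
  classical
  have hd0 : d ≠ 0 := hd.ne'
  suffices key : ∀ j ≤ n, ∃ P : Submodule ℚ (ι → ℚ), (∀ v ∈ P, MA *ᵥ v ∈ P) ∧
      Module.finrank ℚ P = 2 * j ∧ ∀ x ∈ P, x ≠ 0 → 0 < x ⬝ᵥ GA *ᵥ (MA *ᵥ x) from key n le_rfl
  intro j
  induction j with
  | zero =>
    exact fun _ => ⟨⊥, fun v hv => by rw [(Submodule.mem_bot ℚ).1 hv, Matrix.mulVec_zero]; exact zero_mem _,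
      finrank_bot ℚ _, fun x hx hx0 => absurd ((Submodule.mem_bot ℚ).1 hx) hx0⟩
  | succ j ih =>
    intro hj
    obtain ⟨P, hPst, hPf, hPpos⟩ := ih (Nat.le_of_succ_le hj)
    set S : LinearMap.BilinForm ℚ (ι → ℚ) := Matrix.toBilin' (GA * MA) with hS_def
    have hS : ∀ x y, S x y = x ⬝ᵥ GA *ᵥ (MA *ᵥ y) := fun x y => weilSig_apply x y
    have hSsymm : S.IsSymm := Matrix.isSymm_toBilin'_iff_isSymm.2 (weilSig_isSymm hd0 hMA hGA hWt)
    set W := S.orthogonal P with hW_def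
    have hWmem : ∀ v, v ∈ W ↔ ∀ p ∈ P, p ⬝ᵥ GA *ᵥ (MA *ᵥ v) = 0 := fun v => by
      rw [hW_def, LinearMap.BilinForm.mem_orthogonal_iff]
      simp only [hS]
    -- `dim W ≥ |ι| - 2j`
    have hWdim : Fintype.card ι ≤ Module.finrank ℚ W + 2 * j := by
      have h := LinearMap.BilinForm.finrank_add_finrank_orthogonal hSsymm.isRefl P
      rw [← hW_def, Module.finrank_fintype_fun_eq_card, hPf] at h
      omega
    obtain ⟨v, hvW, hvpos⟩ := weilSig_exists_mem_pos (GA * MA) W Z (by omega) hpos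
    rw [← Matrix.mulVec_mulVec] at hvpos
    have hv0 : v ≠ 0 := by
      rintro rfl
      simp at hvpos
    -- `W` is `M_A`-stable
    have hWst : ∀ x ∈ W, MA *ᵥ x ∈ W := by
      intro x hx
      rw [hWmem] at hx ⊢
      intro p hp
      have hp' : (-(1 / d)) • MA *ᵥ p ∈ P := Submodule.smul_mem _ _ (hPst p hp)
      have e : MA *ᵥ ((-(1 / d)) • MA *ᵥ p) = p := by
        rw [Matrix.mulVec_smul, Matrix.mulVec_mulVec, hMA, Matrix.smul_mulVec, Matrix.one_mulVec,
          smul_smul]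
        rw [show -(1 / d) * -d = 1 by field_simp, one_smul]
      rw [← e, weilSig_mulVec_mulVec hWt, hx _ hp', mul_zero]
    set L : Submodule ℚ (ι → ℚ) := Submodule.span ℚ {v, MA *ᵥ v} with hL_def
    have hLW : L ≤ W := by
      rw [hL_def, Submodule.span_le]
      intro x hx
      rcases hx with rfl | rfl
      · exact hvW
      · exact hWst _ hvW
    have hLmem : ∀ x, x ∈ L ↔ ∃ a b : ℚ, a • v + b • MA *ᵥ v = x := fun x => Submodule.mem_span_pair
    -- `v, M_A v` independent, `dim L = 2`
    have hind : LinearIndependent ℚ ![v, MA *ᵥ v] := by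
      rw [LinearIndependent.pair_iff]
      intro s t hst
      have h2 : MA *ᵥ (s • v + t • MA *ᵥ v) = 0 := by rw [hst, Matrix.mulVec_zero]
      rw [Matrix.mulVec_add, Matrix.mulVec_smul, Matrix.mulVec_smul, Matrix.mulVec_mulVec, hMA,
        Matrix.smul_mulVec, Matrix.one_mulVec] at h2
      have h3 : (s * s + d * (t * t)) • v = 0 := by
        have e1 : s • (s • v + t • MA *ᵥ v) - t • (s • MA *ᵥ v + t • (-d) • v) =
            (s * s + d * (t * t)) • v := by
          simp only [smul_add, smul_smul, add_smul]
          module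
        rw [← e1, hst, h2, smul_zero, smul_zero, sub_zero]
      rcases smul_eq_zero.1 h3 with h4 | h4
      · have hs : s = 0 := by nlinarith [mul_self_nonneg s, mul_self_nonneg t]
        have ht : t * t = 0 := by nlinarith [mul_self_nonneg s, mul_self_nonneg t]
        exact ⟨hs, mul_self_eq_zero.1 ht⟩
      · exact absurd h4 hv0
    have hLf : Module.finrank ℚ L = 2 := by
      have e : L = Submodule.span ℚ (Set.range ![v, MA *ᵥ v]) := by
        rw [hL_def, Matrix.range_cons, Matrix.range_cons, Matrix.range_empty, Set.union_empty,
          Set.singleton_union]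
      rw [e, finrank_span_eq_card hind, Fintype.card_fin]
    -- `P ⊓ L = ⊥`
    have hPL : P ⊓ L = ⊥ := by
      rw [Submodule.eq_bot_iff]
      rintro x ⟨hxP, hxL⟩
      by_contra hx0
      have h1 := hPpos x hxP hx0
      have h2 : x ⬝ᵥ GA *ᵥ (MA *ᵥ x) = 0 := (hWmem x).1 (hLW hxL) x hxP
      rw [h2] at h1
      exact lt_irrefl _ h1
    refine ⟨P ⊔ L, ?_, ?_, ?_⟩
    · -- `M_A`-stability
      intro x hx
      obtain ⟨p, hp, l, hl, rfl⟩ := Submodule.mem_sup.1 hx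
      obtain ⟨a, b, rfl⟩ := (hLmem l).1 hl
      rw [Matrix.mulVec_add]
      refine Submodule.add_mem _ (Submodule.mem_sup_left (hPst p hp)) (Submodule.mem_sup_right ?_)
      rw [hLmem]
      refine ⟨b * -d, a, ?_⟩
      rw [Matrix.mulVec_add, Matrix.mulVec_smul, Matrix.mulVec_smul, Matrix.mulVec_mulVec, hMA,
        Matrix.smul_mulVec, Matrix.one_mulVec, smul_smul, add_comm]
    · -- dimension
      have h := Submodule.finrank_sup_add_finrank_inf_eq P L
      rw [hPL, finrank_bot, add_zero, hPf, hLf] at h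
      omega
    · -- positivity
      intro x hx hx0
      obtain ⟨p, hp, l, hl, rfl⟩ := Submodule.mem_sup.1 hx
      have hlW : l ∈ W := hLW hl
      have hcross1 : p ⬝ᵥ GA *ᵥ (MA *ᵥ l) = 0 := (hWmem _).1 hlW p hp
      have hcross2 : l ⬝ᵥ GA *ᵥ (MA *ᵥ p) = 0 := by
        rw [weilSig_comm hd0 hMA hGA hWt, hcross1]
      have e : (p + l) ⬝ᵥ GA *ᵥ (MA *ᵥ (p + l)) =
          p ⬝ᵥ GA *ᵥ (MA *ᵥ p) + l ⬝ᵥ GA *ᵥ (MA *ᵥ l) := by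
        rw [Matrix.mulVec_add, Matrix.mulVec_add, dotProduct_add, add_dotProduct, add_dotProduct, hcross1,
          hcross2]
        ring
      obtain ⟨a, b, hab⟩ := (hLmem l).1 hl
      have hsq : l ⬝ᵥ GA *ᵥ (MA *ᵥ l) = (a ^ 2 + d * b ^ 2) * (v ⬝ᵥ GA *ᵥ (MA *ᵥ v)) := by
        rw [← hab]
        exact weilSig_line hd0 hMA hGA hWt v a b
      rw [e, hsq]
      by_cases hp0 : p = 0
      · subst hp0
        rw [Matrix.mulVec_zero, Matrix.mulVec_zero, dotProduct_zero, zero_add]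
        have hab0 : a ≠ 0 ∨ b ≠ 0 := by
          by_contra h0
          push Not at h0
          apply hx0
          rw [← hab, h0.1, h0.2, zero_smul, zero_smul, add_zero, add_zero]
        have hq : 0 < a ^ 2 + d * b ^ 2 := by
          rcases hab0 with ha | hb
          · have : 0 < a ^ 2 := by positivity
            nlinarith [sq_nonneg b]
          · have : 0 < b ^ 2 := by positivity
            nlinarith [sq_nonneg a]
        exact mul_pos hq hvpos
      · have h1 := hPpos p hp hp0
        have h2 : 0 ≤ (a ^ 2 + d * b ^ 2) * (v ⬝ᵥ GA *ᵥ (MA *ᵥ v)) :=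
          mul_nonneg (by positivity) hvpos.le
        linarith

end WeilPair

/-- **Both signs at once, in the shape `hPN` of `Motives.exists_isotropic_blockVectors'`**: complex
subspaces `Z₊`, `Z₋ ⊆ ℂ^ι` of dimension `≥ 2n` on which `Re S(z, z̄)` is positive, resp. negative, give
`M_A`-stable rational `P`, `N ⊆ ℚ^ι` of dimension `2n`, `S > 0` on `P ∖ 0`, `S < 0` on `N ∖ 0`, `P ⊓ N = 0`
(definiteness). [cite: vanGeemen1994HodgeAV, Lemma 5.2 (4)–(5)] -/
theorem weilSig_exists_PN {d : ℚ} {MA GA : Matrix ι ι ℚ}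
    (hd : 0 < d) (hMA : MA * MA = (-d) • (1 : Matrix ι ι ℚ)) (hGA : GA.transpose = -GA)
    (hWt : MA.transpose * GA * MA = d • GA) (n : ℕ) (Zp Zn : Submodule ℂ (ι → ℂ))
    (hZp : 2 * n ≤ Module.finrank ℂ Zp) (hZn : 2 * n ≤ Module.finrank ℂ Zn)
    (hpos : ∀ z ∈ Zp, z ≠ 0 → 0 < (z ⬝ᵥ ((GA * MA).map (algebraMap ℚ ℂ)).mulVec (star z)).re)
    (hneg : ∀ z ∈ Zn, z ≠ 0 → (z ⬝ᵥ ((GA * MA).map (algebraMap ℚ ℂ)).mulVec (star z)).re < 0) :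
    ∃ P N : Submodule ℚ (ι → ℚ), (∀ v ∈ P, MA.mulVec v ∈ P) ∧ (∀ v ∈ N, MA.mulVec v ∈ N) ∧
      Module.finrank ℚ P = 2 * n ∧ Module.finrank ℚ N = 2 * n ∧ P ⊓ N = ⊥ ∧
      (∀ x ∈ P, x ≠ 0 → 0 < x ⬝ᵥ GA.mulVec (MA.mulVec x)) ∧
      (∀ x ∈ N, x ≠ 0 → x ⬝ᵥ GA.mulVec (MA.mulVec x) < 0) := by
  obtain ⟨P, hPst, hPf, hPpos⟩ := weilSig_exists_stable_posDef hd hMA hGA hWt n Zp hZp hpos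
  -- the negative side: the positive side for `-G_A`
  have hGA' : (-GA)ᵀ = -(-GA) := by rw [Matrix.transpose_neg, hGA]
  have hWt' : MAᵀ * (-GA) * MA = d • (-GA) := by rw [Matrix.mul_neg, Matrix.neg_mul, hWt, smul_neg]
  have hpos' : ∀ z ∈ Zn, z ≠ 0 → 0 < (z ⬝ᵥ (-GA * MA).map (algebraMap ℚ ℂ) *ᵥ star z).re := by
    intro z hz hz0
    have h := hneg z hz hz0
    rw [Matrix.neg_mul, Matrix.map_neg _ (map_neg (algebraMap ℚ ℂ)), Matrix.neg_mulVec, dotProduct_neg,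
      Complex.neg_re]
    linarith
  obtain ⟨N, hNst, hNf, hNpos⟩ := weilSig_exists_stable_posDef hd hMA hGA' hWt' n Zn hZn hpos'
  have hNneg : ∀ x ∈ N, x ≠ 0 → x ⬝ᵥ GA *ᵥ (MA *ᵥ x) < 0 := fun x hx hx0 => by
    have h := hNpos x hx hx0
    rw [Matrix.neg_mulVec, dotProduct_neg] at h
    linarith
  refine ⟨P, N, hPst, hNst, hPf, hNf, ?_, hPpos, hNneg⟩
  rw [Submodule.eq_bot_iff]
  rintro x ⟨hxP, hxN⟩
  by_contra hx0
  exact lt_asymm (hPpos x hxP hx0) (hNneg x hxN hx0)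

end Rational

/-! ## Part II: coordinates in a basis with rational structure constants; conjugation -/

section Coordinates

variable {ι : Type*} [Fintype ι] {V W : Type*} [AddCommGroup V] [Module ℂ V] [AddCommGroup W] [Module ℂ W]
  (b : Module.Basis ι ℂ V)

/-- **An endomorphism with matrix `M_A` in the basis acts on coordinates by `M_A`**: if
`T bᵢ = Σⱼ M_A j i • bⱼ` then `b.equivFun (T x) = M_A · b.equivFun x`. [folklore] -/
theorem weilSig_equivFun_map [DecidableEq ι] {T : V →ₗ[ℂ] V} {MA : Matrix ι ι ℚ}
    (hT : ∀ i, T (b i) = ∑ j, ((MA j i : ℚ) : ℂ) • b j) (x : V) :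
    b.equivFun (T x) = (MA.map (algebraMap ℚ ℂ)).mulVec (b.equivFun x) := by
  conv_lhs => rw [← b.sum_equivFun x]
  rw [map_sum]
  simp_rw [map_smul, hT, Finset.smul_sum, smul_smul]
  rw [Finset.sum_comm]
  have e : ∀ j, ∑ i, (b.equivFun x i * ((MA j i : ℚ) : ℂ)) • b j =
      (∑ i, ((MA j i : ℚ) : ℂ) * b.equivFun x i) • b j := fun j => by
    rw [← Finset.sum_smul]
    simp_rw [mul_comm]
  simp_rw [e]
  rw [map_sum]
  simp_rw [map_smul]
  funext k
  simp only [Finset.sum_apply, Pi.smul_apply, Module.Basis.equivFun_self, smul_eq_mul, mul_ite, mul_one,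
    mul_zero, Finset.sum_ite_eq', Finset.mem_univ, if_true]
  rfl

/-- **A bilinear map with Gram matrix `G_A • ω` in the basis is `(x ⬝ G_A y) • ω` in coordinates.**
[folklore] -/
theorem weilSig_pairing_eq {Q : V →ₗ[ℂ] V →ₗ[ℂ] W} {GA : Matrix ι ι ℚ} {ω : W}
    (hQ : ∀ i j, Q (b i) (b j) = ((GA i j : ℚ) : ℂ) • ω) (x y : V) :
    Q x y = (b.equivFun x ⬝ᵥ (GA.map (algebraMap ℚ ℂ)).mulVec (b.equivFun y)) • ω := by
  conv_lhs => rw [← b.sum_equivFun x, ← b.sum_equivFun y]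
  rw [weilSig_bilin_sum_sum]
  simp_rw [hQ, smul_smul, ← Finset.sum_smul]
  congr 1
  simp only [dotProduct, Matrix.mulVec, Matrix.map_apply, Finset.mul_sum]
  refine Finset.sum_congr rfl fun i _ => Finset.sum_congr rfl fun j _ => ?_
  change _ = _ * ((GA i j : ℂ) * _)
  ring

/-- **`T² = -d` forces `M_A² = -d`** for the rational matrix `M_A` of `T` in the basis (`ℚ ↪ ℂ` and two
matrices with the same action on `ℂ^ι` are equal). [folklore] -/
theorem weilSig_matrix_sq [DecidableEq ι] {T : V →ₗ[ℂ] V} {MA : Matrix ι ι ℚ}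
    (hT : ∀ i, T (b i) = ∑ j, ((MA j i : ℚ) : ℂ) • b j) {d : ℚ}
    (hTT : ∀ x, T (T x) = -(((d : ℚ) : ℂ) • x)) : MA * MA = (-d) • (1 : Matrix ι ι ℚ) := by
  have hv : ∀ v : ι → ℂ, (MA * MA).map (algebraMap ℚ ℂ) *ᵥ v = ((-d) • (1 : Matrix ι ι ℚ)).map (algebraMap ℚ ℂ) *ᵥ v := by
    intro v
    set x := b.equivFun.symm v with hx
    have hxv : b.equivFun x = v := LinearEquiv.apply_symm_apply _ v
    have h1 : b.equivFun (T (T x)) = (MA * MA).map (algebraMap ℚ ℂ) *ᵥ v := by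
      rw [weilSig_equivFun_map b hT (T x), weilSig_equivFun_map b hT x, hxv, Matrix.mulVec_mulVec,
        ← Matrix.map_mul]
    have h2 : b.equivFun (T (T x)) = -(((d : ℚ) : ℂ) • v) := by
      rw [hTT, map_neg, map_smul, hxv]
    have e : ((-d) • (1 : Matrix ι ι ℚ)).map (algebraMap ℚ ℂ) = (-((d : ℚ) : ℂ)) • (1 : Matrix ι ι ℂ) := by
      ext i j
      by_cases hij : i = j <;> simp [hij]
    rw [← h1, h2, e, Matrix.smul_mulVec, Matrix.one_mulVec, neg_smul]
  have hm : (MA * MA).map (algebraMap ℚ ℂ) = ((-d) • (1 : Matrix ι ι ℚ)).map (algebraMap ℚ ℂ) :=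
    Matrix.toLin'.injective (LinearMap.ext fun v => by rw [Matrix.toLin'_apply, Matrix.toLin'_apply, hv])
  exact Matrix.map_injective (algebraMap ℚ ℂ).injective hm

end Coordinates

section Conjugation

/-- Conjugation of a finite sum of classes. [folklore] -/
theorem weilSig_conjClass_sum {Y : Type u} [TopologicalSpace Y] {k : ℕ} {κ : Type*} (s : Finset κ)
    (f : κ → singularCohomology ℂ ℂ Y k) :
    conjClass Y k (∑ i ∈ s, f i) = ∑ i ∈ s, conjClass Y k (f i) :=
  map_sum (conjClassEquiv Y k) f s

/-- **In a basis of rational (hence real, `IsRationalClass.conjClass_eq`) classes, conjugation of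
`Hᵏ(Y; ℂ)` is coordinatewise complex conjugation.** [cite: VoisinHodgeI2002, Cor. 6.12] -/
theorem weilSig_equivFun_conjClass {Y : Type*} [TopologicalSpace Y] {k : ℕ} {ι : Type*} [Fintype ι]
    (b : Module.Basis ι ℂ (singularCohomology ℂ ℂ Y k)) (hb : ∀ i, IsRationalClass (b i))
    (x : singularCohomology ℂ ℂ Y k) : b.equivFun (conjClass Y k x) = star (b.equivFun x) := by
  conv_lhs => rw [← b.sum_equivFun x]
  rw [weilSig_conjClass_sum]
  simp_rw [conjClass_smul, (hb _).conjClass_eq]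
  funext j
  rw [Module.Basis.equivFun_apply, Module.Basis.repr_sum_self]
  rfl

end Conjugation

/-! ## Part III: van Geemen's Hermitian form -/

section Hermitian

variable {ι : Type*} [Fintype ι] {V W : Type*} [AddCommGroup V] [Module ℂ V] [AddCommGroup W] [Module ℂ W]

/-! ### Conjugate-linear maps: sums, dimensions -/

omit [Fintype ι] in
/-- A conjugate-linear map on finite combinations: `κ (Σ gᵢ xᵢ) = Σ ḡᵢ κ xᵢ`. [folklore] -/
theorem weilSig_semilinear_sum (κ : V → V) (hκa : ∀ x y, κ (x + y) = κ x + κ y)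
    (hκs : ∀ (c : ℂ) (x : V), κ (c • x) = conj c • κ x) {α : Type*} (s : Finset α) (g : α → ℂ) (x : α → V) :
    κ (∑ i ∈ s, g i • x i) = ∑ i ∈ s, conj (g i) • κ (x i) := by
  classical
  have hκ0 : κ 0 = 0 := by simpa using hκs 0 0
  induction s using Finset.induction_on with
  | empty => simp [hκ0]
  | insert a s ha ih => rw [Finset.sum_insert ha, Finset.sum_insert ha, hκa, hκs, ih]

omit [Fintype ι] in
/-- **A subspace mapped by a conjugate-linear involution into another has at most its dimension** (the
images of a basis stay independent: conjugate the relation). [folklore] -/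
theorem weilSig_finrank_le_of_semilinear [Module.Finite ℂ V] (κ : V → V) (hκa : ∀ x y, κ (x + y) = κ x + κ y)
    (hκs : ∀ (c : ℂ) (x : V), κ (c • x) = conj c • κ x) (hκκ : ∀ x, κ (κ x) = x)
    (S₁ S₂ : Submodule ℂ V) (h : ∀ x ∈ S₁, κ x ∈ S₂) : Module.finrank ℂ S₁ ≤ Module.finrank ℂ S₂ := by
  classical
  let bS := Module.finBasis ℂ S₁
  let f : Fin (Module.finrank ℂ S₁) → S₂ := fun i => ⟨κ (bS i), h _ (bS i).2⟩
  have hf : LinearIndependent ℂ f := by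
    rw [Fintype.linearIndependent_iff]
    intro g hg i
    have h1 : ∑ i, g i • κ (bS i : V) = 0 := by
      have h0 := congrArg (S₂.subtype) hg
      rw [map_sum, map_zero] at h0
      simpa only [map_smul, Submodule.subtype_apply, f] using h0
    have h2 : κ (∑ i, g i • κ (bS i : V)) = ∑ i, conj (g i) • (bS i : V) := by
      rw [weilSig_semilinear_sum κ hκa hκs]
      simp_rw [hκκ]
    rw [h1, show κ 0 = 0 by simpa using hκs 0 0] at h2
    have h3 : ∑ i, conj (g i) • bS i = 0 := by
      apply S₁.subtype_injective
      rw [map_sum, map_zero]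
      simpa only [map_smul, Submodule.subtype_apply] using h2.symm
    have h4 := Fintype.linearIndependent_iff.1 bS.linearIndependent _ h3 i
    simpa using h4
  simpa using hf.fintype_card_le_finrank

/-! ### The Hermitian form on a sum of two orthogonal pieces -/

/-- **Van Geemen's Hermitian form on a sum of two pieces** (LNM 1594, proof of Lemma 5.2 (4): `H` is
definite on `V₊^{1,0} ⊕ V₋^{0,1}`). Let `C` be a SYMMETRIC complex `ι × ι` matrix, `β : V ≃ ℂ^ι`
coordinates, `κ : V → V` with `β (κ v) = \overline{β v}`, and `H(v) = Re (βv ⬝ C \overline{βv})`. If `H > 0` on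
`X ∖ 0`, `κ` maps `Y` into `X`, and `βx ⬝ C \overline{βy} = 0 = βy ⬝ C \overline{βx}` for `x ∈ X`, `y ∈ Y`, then
`H > 0` on `β(X ⊔ Y) ∖ 0`: `H(x + y) = H(x) + H(y)` and `H(y) = H(κ y)` by the symmetry of `C`.
[cite: vanGeemen1994HodgeAV, proof of Lemma 5.2 (4)] -/
theorem weilSig_re_pos_sup (β : V ≃ₗ[ℂ] (ι → ℂ)) (κ : V → V) (hκ : ∀ v, β (κ v) = star (β v))
    (C : Matrix ι ι ℂ) (hC : C.transpose = C) (X Y : Submodule ℂ V)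
    (hX : ∀ x ∈ X, x ≠ 0 → 0 < (β x ⬝ᵥ C.mulVec (star (β x))).re) (hYX : ∀ y ∈ Y, κ y ∈ X)
    (hXY : ∀ x ∈ X, ∀ y ∈ Y, β x ⬝ᵥ C.mulVec (star (β y)) = 0)
    (hYX' : ∀ x ∈ X, ∀ y ∈ Y, β y ⬝ᵥ C.mulVec (star (β x)) = 0) :
    ∀ z ∈ (X ⊔ Y).map (β : V →ₗ[ℂ] (ι → ℂ)), z ≠ 0 → 0 < (z ⬝ᵥ C.mulVec (star z)).re := by
  intro z hz hz0
  obtain ⟨v, hv, rfl⟩ := Submodule.mem_map.1 hz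
  obtain ⟨x, hx, y, hy, rfl⟩ := Submodule.mem_sup.1 hv
  rw [LinearEquiv.coe_coe] at hz0 ⊢
  have hsymm : ∀ a c : ι → ℂ, a ⬝ᵥ C *ᵥ c = c ⬝ᵥ C *ᵥ a := fun a c => by
    conv_lhs => rw [Matrix.dotProduct_mulVec, ← Matrix.mulVec_transpose, hC, dotProduct_comm]
  have e : β (x + y) ⬝ᵥ C *ᵥ star (β (x + y)) =
      β x ⬝ᵥ C *ᵥ star (β x) + β y ⬝ᵥ C *ᵥ star (β y) := by
    rw [map_add, star_add, Matrix.mulVec_add, dotProduct_add, add_dotProduct, add_dotProduct, hXY x hx y hy,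
      hYX' x hx y hy]
    ring
  have ey : β y ⬝ᵥ C *ᵥ star (β y) = β (κ y) ⬝ᵥ C *ᵥ star (β (κ y)) := by
    rw [hκ, star_star, hsymm]
  have hκ0 : ∀ w : V, κ w = 0 ↔ w = 0 := fun w => by
    constructor
    · intro h0
      have h1 : star (β w) = 0 := by rw [← hκ, h0, map_zero]
      exact β.injective (by rw [map_zero]; exact star_eq_zero.1 h1)
    · intro h0
      apply β.injective
      rw [hκ, h0, map_zero, star_zero]
  have Hx : 0 ≤ (β x ⬝ᵥ C *ᵥ star (β x)).re ∧ (x ≠ 0 → 0 < (β x ⬝ᵥ C *ᵥ star (β x)).re) := by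
    by_cases hx0 : x = 0
    · subst hx0
      simp
    · exact ⟨(hX x hx hx0).le, fun _ => hX x hx hx0⟩
  have Hy : 0 ≤ (β y ⬝ᵥ C *ᵥ star (β y)).re ∧ (y ≠ 0 → 0 < (β y ⬝ᵥ C *ᵥ star (β y)).re) := by
    rw [ey]
    by_cases hy0 : y = 0
    · subst hy0
      rw [(hκ0 0).2 rfl]
      simp
    · have hκy : κ y ≠ 0 := fun h0 => hy0 ((hκ0 y).1 h0)
      exact ⟨(hX _ (hYX y hy) hκy).le, fun _ => hX _ (hYX y hy) hκy⟩
  rw [e, Complex.add_re]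
  by_cases hx0 : x = 0
  · have hy0 : y ≠ 0 := by
      rintro rfl
      rw [hx0, add_zero, map_zero] at hz0
      exact hz0 rfl
    linarith [Hx.1, Hy.2 hy0]
  · linarith [Hx.2 hx0, Hy.1]

/-! ### The pieces `Z_μ = (V_μ ∩ H^{1,0}) ⊕ (V_{-μ} ∩ H^{0,1})` -/

section Piece

variable (T : V →ₗ[ℂ] V) (Q : V →ₗ[ℂ] V →ₗ[ℂ] W) (κ : V → V) (β : V ≃ₗ[ℂ] (ι → ℂ))
  {MA GA : Matrix ι ι ℚ} {ω : W} {dC : ℂ}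

omit [Fintype ι] in
/-- Isotropy of the eigenspaces (van Geemen 5.2, proof of (4)): if `Q(T x, T y) = d Q(x, y)` (Weil type,
`d ≠ 0`) and `T x = ν x`, `T y = ν y` with `ν² = -d`, then `Q(x, y) = 0`.
[cite: vanGeemen1994HodgeAV, proof of Lemma 5.2 (4)] -/
theorem weilSig_isotropic (hd : dC ≠ 0) (hQT : ∀ x y, Q (T x) (T y) = dC • Q x y) {ν : ℂ}
    (hν : ν * ν = -dC) {x y : V} (hx : T x = ν • x) (hy : T y = ν • y) : Q x y = 0 := by
  have h := hQT x y
  rw [hx, hy, map_smul, map_smul, LinearMap.smul_apply, smul_smul, hν] at h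
  have h2 : (dC + dC) • Q x y = 0 := by
    rw [add_smul]
    nth_rewrite 1 [← h]
    rw [neg_smul, neg_add_cancel]
  rcases smul_eq_zero.1 h2 with h3 | h3
  · exact absurd h3 (by rw [← two_mul]; exact mul_ne_zero two_ne_zero hd)
  · exact h3

/-- **Sign of `Re H` on the piece `Z_μ`.** Data as in the module docstring; `μ` with `μ² = -d`, `μ̄ = -μ`,
`μ · i = m ∈ ℝ`, `m ≠ 0`; Hodge–Riemann: `i Q(x, κ x) = (t ρ) ω` with `t > 0` for `0 ≠ x ∈ H^{1,0}`, `ρ ≠ 0`.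
Then `m ρ · Re (z ⬝ C z̄) > 0` for `0 ≠ z ∈ β((V_μ ∩ H^{1,0}) ⊔ (V_{-μ} ∩ H^{0,1}))`: on `x ∈ V_μ ∩ H^{1,0}`,
`(βx ⬝ C \overline{βx}) ω = Q(x, T κx) = -μ Q(x, κ x) = (m t ρ) ω`; `κ` maps `V_{-μ} ∩ H^{0,1}` into
`V_μ ∩ H^{1,0}`; the cross terms vanish by isotropy of `V_{±μ}`; conclude by `weilSig_re_pos_sup` for the
symmetric matrix `(m ρ) C`. [cite: vanGeemen1994HodgeAV, proof of Lemma 5.2 (4)] -/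
theorem weilSig_piece (hω0 : ω ≠ 0) (hsymm : ((GA * MA).map (algebraMap ℚ ℂ)).transpose = (GA * MA).map (algebraMap ℚ ℂ))
    (hd : dC ≠ 0) (hQT : ∀ x y, Q (T x) (T y) = dC • Q x y)
    (hH : ∀ x y, Q x (T (κ y)) = (β x ⬝ᵥ (GA * MA).map (algebraMap ℚ ℂ) *ᵥ star (β y)) • ω)
    (hβκ : ∀ x, β (κ x) = star (β x)) (hTκ : ∀ x, T (κ x) = κ (T x))
    (hκs : ∀ (c : ℂ) (x : V), κ (c • x) = conj c • κ x)
    {μ : ℂ} (hμ7 : μ * μ = -dC) (hμc : conj μ = -μ) {m : ℝ} (hm0 : m ≠ 0) (hμI : μ * Complex.I = (m : ℂ))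
    (H10 H01 : Submodule ℂ V) (hκ01 : ∀ x ∈ H01, κ x ∈ H10) {ρ : ℝ} (hρ0 : ρ ≠ 0)
    (hHR : ∀ x ∈ H10, x ≠ 0 → ∃ t : ℝ, 0 < t ∧ Complex.I • Q x (κ x) = ((t : ℂ) * ρ) • ω) :
    ∀ z ∈ ((Module.End.eigenspace T μ ⊓ H10) ⊔ (Module.End.eigenspace T (-μ) ⊓ H01)).map
        (β : V →ₗ[ℂ] (ι → ℂ)),
      z ≠ 0 → 0 < m * ρ * (z ⬝ᵥ (GA * MA).map (algebraMap ℚ ℂ) *ᵥ star z).re := by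
  set C := (GA * MA).map (algebraMap ℚ ℂ) with hC_def
  -- `κ` on eigenvectors
  have hκeig : ∀ {ν : ℂ} {x : V}, T x = ν • x → T (κ x) = conj ν • κ x := fun hx => by
    rw [hTκ, hx, hκs]
  have hneg7 : (-μ) * (-μ) = -dC := by rw [neg_mul_neg, hμ7]
  -- `H(x) = m t ρ` on `V_μ ∩ H^{1,0}`
  have hval : ∀ x ∈ Module.End.eigenspace T μ ⊓ H10, x ≠ 0 →
      ∃ t : ℝ, 0 < t ∧ β x ⬝ᵥ C *ᵥ star (β x) = ((m * t * ρ : ℝ) : ℂ) := by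
    rintro x ⟨hxμ, hx10⟩ hx0
    obtain ⟨t, ht, hHRx⟩ := hHR x hx10 hx0
    refine ⟨t, ht, smul_left_injective ℂ hω0 ?_⟩
    have hTκx : T (κ x) = (-μ) • κ x := by rw [hκeig (Module.End.mem_eigenspace_iff.1 hxμ), hμc]
    have e1 : Q x (κ x) = (-Complex.I * ((t : ℂ) * ρ)) • ω := by
      have e2 : Q x (κ x) = (-Complex.I) • (Complex.I • Q x (κ x)) := by
        rw [smul_smul, show -Complex.I * Complex.I = 1 by rw [neg_mul, Complex.I_mul_I, neg_neg], one_smul]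
      rw [e2, hHRx, smul_smul]
    change (β x ⬝ᵥ C *ᵥ star (β x)) • ω = _
    rw [← hH, hTκx, map_smul, e1, smul_smul]
    congr 1
    push_cast
    linear_combination ((t : ℂ) * ρ) * hμI
  -- the scaled symmetric matrix
  set C' : Matrix ι ι ℂ := ((m * ρ : ℝ) : ℂ) • C with hC'_def
  have hC' : C'.transpose = C' := by rw [hC'_def, Matrix.transpose_smul, hsymm]
  have hC'app : ∀ a c : ι → ℂ, a ⬝ᵥ C' *ᵥ c = ((m * ρ : ℝ) : ℂ) * (a ⬝ᵥ C *ᵥ c) := fun a c => by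
    rw [hC'_def, Matrix.smul_mulVec, dotProduct_smul, smul_eq_mul]
  have key := weilSig_re_pos_sup β κ hβκ C' hC' (Module.End.eigenspace T μ ⊓ H10)
    (Module.End.eigenspace T (-μ) ⊓ H01) ?_ ?_ ?_ ?_
  · intro z hz hz0
    have h := key z hz hz0
    rwa [hC'app, Complex.re_ofReal_mul] at h
  · -- `H > 0` on `X`
    intro x hx hx0
    obtain ⟨t, ht, hv⟩ := hval x hx hx0
    rw [hC'app, hv, ← Complex.ofReal_mul, Complex.ofReal_re,
      show m * ρ * (m * t * ρ) = m * m * (ρ * ρ) * t by ring]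
    exact mul_pos (mul_pos (mul_self_pos.2 hm0) (mul_self_pos.2 hρ0)) ht
  · -- `κ Y ⊆ X`
    rintro y ⟨hyμ, hy01⟩
    refine ⟨Module.End.mem_eigenspace_iff.2 ?_, hκ01 y hy01⟩
    rw [hκeig (Module.End.mem_eigenspace_iff.1 hyμ), map_neg, hμc, neg_neg]
  · -- `X ⊥ Y`
    rintro x ⟨hxμ, -⟩ y ⟨hyμ, -⟩
    rw [hC'app]
    refine mul_eq_zero_of_right _ (smul_left_injective ℂ hω0 ?_)
    change (β x ⬝ᵥ C *ᵥ star (β y)) • ω = (0 : ℂ) • ω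
    have hTκy : T (κ y) = μ • κ y := by
      rw [hκeig (Module.End.mem_eigenspace_iff.1 hyμ), map_neg, hμc, neg_neg]
    rw [← hH, hTκy, map_smul, weilSig_isotropic T Q hd hQT hμ7 (Module.End.mem_eigenspace_iff.1 hxμ) hTκy,
      smul_zero, zero_smul]
  · -- `Y ⊥ X`
    rintro x ⟨hxμ, -⟩ y ⟨hyμ, -⟩
    rw [hC'app]
    refine mul_eq_zero_of_right _ (smul_left_injective ℂ hω0 ?_)
    change (β y ⬝ᵥ C *ᵥ star (β x)) • ω = (0 : ℂ) • ω
    have hTκx : T (κ x) = (-μ) • κ x := by rw [hκeig (Module.End.mem_eigenspace_iff.1 hxμ), hμc]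
    rw [← hH, hTκx, map_smul, weilSig_isotropic T Q hd hQT hneg7 (Module.End.mem_eigenspace_iff.1 hyμ) hTκx,
      smul_zero, zero_smul]

omit [Fintype ι] in
/-- **`dim Z_μ ≥ 2n`**: `κ` maps `V_μ ∩ H^{1,0}` (dimension `n`) into `V_{-μ} ∩ H^{0,1}`, conjugate-linearly and
injectively, and `V_μ ∩ V_{-μ} = 0` (`μ ≠ 0`). [cite: vanGeemen1994HodgeAV, proof of Lemma 5.2 (4)] -/
theorem weilSig_piece_finrank [Module.Finite ℂ V] (hβκ : ∀ x, β (κ x) = star (β x))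
    (hTκ : ∀ x, T (κ x) = κ (T x)) (hκs : ∀ (c : ℂ) (x : V), κ (c • x) = conj c • κ x)
    {μ : ℂ} (hμ0 : μ ≠ 0) (hμc : conj μ = -μ) (H10 H01 : Submodule ℂ V) (hκ10 : ∀ x ∈ H10, κ x ∈ H01)
    {n : ℕ} (hn : Module.finrank ℂ ↥(Module.End.eigenspace T μ ⊓ H10) = n) :
    2 * n ≤ Module.finrank ℂ ↥(((Module.End.eigenspace T μ ⊓ H10) ⊔ (Module.End.eigenspace T (-μ) ⊓ H01)).map
      (β : V →ₗ[ℂ] (ι → ℂ))) := by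
  have hκa : ∀ x y, κ (x + y) = κ x + κ y := fun x y =>
    β.injective (by rw [hβκ, map_add, map_add, star_add, hβκ, hβκ])
  have hκκ : ∀ x, κ (κ x) = x := fun x => β.injective (by rw [hβκ, hβκ, star_star])
  set X := Module.End.eigenspace T μ ⊓ H10
  set Y := Module.End.eigenspace T (-μ) ⊓ H01
  have hXY : ∀ x ∈ X, κ x ∈ Y := by
    rintro x ⟨hxμ, hx10⟩
    refine ⟨Module.End.mem_eigenspace_iff.2 ?_, hκ10 x hx10⟩
    rw [hTκ, Module.End.mem_eigenspace_iff.1 hxμ, hκs, hμc]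
  have hY : n ≤ Module.finrank ℂ Y := hn ▸ weilSig_finrank_le_of_semilinear κ hκa hκs hκκ X Y hXY
  have hdis : X ⊓ Y = ⊥ := by
    rw [Submodule.eq_bot_iff]
    rintro x ⟨⟨hxμ, -⟩, ⟨hxμ', -⟩⟩
    have h1 := Module.End.mem_eigenspace_iff.1 hxμ
    have h2 := Module.End.mem_eigenspace_iff.1 hxμ'
    rw [h1, neg_smul] at h2
    have h3 : ((2 : ℂ) * μ) • x = 0 := by
      rw [mul_smul, two_smul]
      nth_rewrite 1 [h2]
      rw [neg_add_cancel]
    rcases smul_eq_zero.1 h3 with h | h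
    · exact absurd h (mul_ne_zero two_ne_zero hμ0)
    · exact h
  rw [LinearEquiv.finrank_map_eq]
  have h := Submodule.finrank_sup_add_finrank_inf_eq X Y
  rw [hdis, finrank_bot, add_zero, hn] at h
  omega

end Piece

/-! ### Both pieces: `Z₊` and `Z₋` -/

/-- **The two definite pieces of `H¹`** (van Geemen 1994, proof of Lemma 5.2 (4): `H` has signature `(n, n)`,
being definite of opposite signs on `Z₁ = V₊^{1,0} ⊕ V₋^{0,1}` and `Z₂ = V₋^{1,0} ⊕ V₊^{0,1}`, each of dimension
`2n`). With `s = m i`, `m > 0`, `m² = d` (so `s = i√d`), `T = φ^*` with rational matrix `M_A`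
(`β (T x) = M_A βx`), `Q` with rational Gram matrix `G_A` (`Q x y = (βx ⬝ G_A βy) ω`, `ω ≠ 0`), `M_A² = -d`,
`G_A` alternating of Weil type, `κ` a coordinatewise conjugation commuting with `T`, Hodge pieces `H^{1,0}`,
`H^{0,1}` swapped by `κ`, multiplicities `dim (V_{±s} ∩ H^{1,0}) = n`, and Hodge–Riemann in the form
`i Q(x, κ x) = (t ρ) ω`, `t > 0`, on `H^{1,0} ∖ 0` for a fixed real `ρ ≠ 0`: there are complex subspaces
`Z₊`, `Z₋ ⊆ ℂ^ι` of dimension `≥ 2n` with `Re (z ⬝ G_A M_A z̄) > 0` on `Z₊ ∖ 0` and `< 0` on `Z₋ ∖ 0`.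
[cite: vanGeemen1994HodgeAV, Lemma 5.2 (4)] -/
theorem weilSig_exists_Zp_Zn {ι : Type*} [Fintype ι] [DecidableEq ι] {V W : Type*} [AddCommGroup V]
    [Module ℂ V] [Module.Finite ℂ V] [AddCommGroup W] [Module ℂ W] (T : V →ₗ[ℂ] V)
    (Q : V →ₗ[ℂ] V →ₗ[ℂ] W) (κ : V → V) (β : V ≃ₗ[ℂ] (ι → ℂ)) {d : ℚ} {MA GA : Matrix ι ι ℚ} {ω : W}
    (hd : 0 < d) (hω0 : ω ≠ 0) (hMA : MA * MA = (-d) • (1 : Matrix ι ι ℚ)) (hGA : GA.transpose = -GA)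
    (hWt : MA.transpose * GA * MA = d • GA)
    (hβT : ∀ x, β (T x) = (MA.map (algebraMap ℚ ℂ)).mulVec (β x))
    (hβQ : ∀ x y, Q x y = (β x ⬝ᵥ (GA.map (algebraMap ℚ ℂ)).mulVec (β y)) • ω)
    (hβκ : ∀ x, β (κ x) = star (β x)) (hTκ : ∀ x, T (κ x) = κ (T x))
    (hκs : ∀ (c : ℂ) (x : V), κ (c • x) = (starRingEnd ℂ) c • κ x)
    {m : ℝ} (hm : 0 < m) (hm7 : m * m = d) {s : ℂ} (hs : s = (m : ℂ) * Complex.I)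
    (H10 H01 : Submodule ℂ V) (hκ01 : ∀ x ∈ H01, κ x ∈ H10) (hκ10 : ∀ x ∈ H10, κ x ∈ H01) {n : ℕ}
    (hVp : Module.finrank ℂ ↥(Module.End.eigenspace T s ⊓ H10) = n)
    (hVm : Module.finrank ℂ ↥(Module.End.eigenspace T (-s) ⊓ H10) = n) {ρ : ℝ} (hρ0 : ρ ≠ 0)
    (hHR : ∀ x ∈ H10, x ≠ 0 → ∃ t : ℝ, 0 < t ∧ Complex.I • Q x (κ x) = ((t : ℂ) * ρ) • ω) :
    ∃ Zp Zn : Submodule ℂ (ι → ℂ), 2 * n ≤ Module.finrank ℂ Zp ∧ 2 * n ≤ Module.finrank ℂ Zn ∧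
      (∀ z ∈ Zp, z ≠ 0 → 0 < (z ⬝ᵥ ((GA * MA).map (algebraMap ℚ ℂ)).mulVec (star z)).re) ∧
      (∀ z ∈ Zn, z ≠ 0 → (z ⬝ᵥ ((GA * MA).map (algebraMap ℚ ℂ)).mulVec (star z)).re < 0) := by
  -- arithmetic of `s`
  set dC : ℂ := ((d : ℚ) : ℂ) with hdC_def
  have hdC0 : dC ≠ 0 := by rw [hdC_def]; exact_mod_cast hd.ne'
  have hII : Complex.I * Complex.I = -1 := Complex.I_mul_I
  have hmm : (m : ℂ) * (m : ℂ) = dC := by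
    rw [hdC_def, ← Complex.ofReal_ratCast, ← hm7, Complex.ofReal_mul]
  have hs7 : s * s = -dC := by
    rw [hs]
    linear_combination ((m : ℂ) * (m : ℂ)) * hII - hmm
  have hsc : (starRingEnd ℂ) s = -s := by
    rw [hs, map_mul, Complex.conj_ofReal, Complex.conj_I]
    ring
  have hnsc : (starRingEnd ℂ) (-s) = -(-s) := by rw [map_neg, hsc]
  have hns7 : (-s) * (-s) = -dC := by rw [neg_mul_neg, hs7]
  have hsI : s * Complex.I = ((-m : ℝ) : ℂ) := by
    rw [hs]
    push_cast
    linear_combination (m : ℂ) * hII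
  have hnsI : (-s) * Complex.I = (m : ℂ) := by
    rw [neg_mul, hsI]
    push_cast
    ring
  have hs0 : s ≠ 0 := by
    rw [hs]
    exact mul_ne_zero (by exact_mod_cast hm.ne') Complex.I_ne_zero
  -- matrix identities over `ℂ`
  set C := (GA * MA).map (algebraMap ℚ ℂ) with hC_def
  have hsymm : C.transpose = C := by
    have h2 : (GA * MA).transpose = GA * MA := weilSig_isSymm hd.ne' hMA hGA hWt
    rw [hC_def, ← Matrix.transpose_map, h2]
  have hQT : ∀ x y, Q (T x) (T y) = dC • Q x y := by
    intro x y
    rw [hβQ, hβQ x y, hβT, hβT, smul_smul]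
    congr 1
    have h := Matrix.toBilin'_comp (GA.map (algebraMap ℚ ℂ)) (MA.map (algebraMap ℚ ℂ)) (MA.map (algebraMap ℚ ℂ))
    rw [← Matrix.transpose_map, ← Matrix.map_mul, ← Matrix.map_mul, hWt] at h
    have h' := congrArg (fun B : LinearMap.BilinForm ℂ (ι → ℂ) => B (β x) (β y)) h
    simp only [LinearMap.BilinForm.comp_apply, Matrix.toLin'_apply, Matrix.toBilin'_apply'] at h'
    rw [h']
    have e : (d • GA).map (algebraMap ℚ ℂ) = dC • GA.map (algebraMap ℚ ℂ) := by
      ext i j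
      simp [hdC_def]
    rw [e, Matrix.smul_mulVec, dotProduct_smul, smul_eq_mul]
  have hH : ∀ x y, Q x (T (κ y)) = (β x ⬝ᵥ C *ᵥ star (β y)) • ω := by
    intro x y
    rw [hβQ, hβT, hβκ, Matrix.mulVec_mulVec, ← Matrix.map_mul]
  -- the two pieces
  have hP1 := weilSig_piece T Q κ β hω0 hsymm hdC0 hQT hH hβκ hTκ hκs hs7 hsc (neg_ne_zero.2 hm.ne') hsI H10 H01
    hκ01 hρ0 hHR
  have hP2 := weilSig_piece T Q κ β hω0 hsymm hdC0 hQT hH hβκ hTκ hκs hns7 hnsc hm.ne' hnsI H10 H01 hκ01 hρ0 hHR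
  have hF1 := weilSig_piece_finrank T κ β hβκ hTκ hκs hs0 hsc H10 H01 hκ10 hVp
  have hF2 := weilSig_piece_finrank T κ β hβκ hTκ hκs (neg_ne_zero.2 hs0) hnsc H10 H01 hκ10 hVm
  rw [neg_neg] at hP2 hF2
  set Z1 := ((Module.End.eigenspace T s ⊓ H10) ⊔ (Module.End.eigenspace T (-s) ⊓ H01)).map
    (β : V →ₗ[ℂ] (ι → ℂ))
  set Z2 := ((Module.End.eigenspace T (-s) ⊓ H10) ⊔ (Module.End.eigenspace T s ⊓ H01)).map
    (β : V →ₗ[ℂ] (ι → ℂ))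
  -- sign bookkeeping: `0 < a r` gives `r` the sign of `a`
  have sgn : ∀ {a r : ℝ}, 0 < a * r → (0 < a → 0 < r) ∧ (a < 0 → r < 0) := fun {a r} h => by
    rcases pos_and_pos_or_neg_and_neg_of_mul_pos h with ⟨ha, hr⟩ | ⟨ha, hr⟩
    · exact ⟨fun _ => hr, fun ha' => absurd ha (not_lt.2 ha'.le)⟩
    · exact ⟨fun ha' => absurd ha' (not_lt.2 ha.le), fun _ => hr⟩
  rcases lt_or_gt_of_ne hρ0 with hρ | hρ
  · -- `ρ < 0`: `Z₊ = Z₁`, `Z₋ = Z₂`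
    refine ⟨Z1, Z2, hF1, hF2, fun z hz hz0 => (sgn (hP1 z hz hz0)).1 (by nlinarith),
      fun z hz hz0 => (sgn (hP2 z hz hz0)).2 (by nlinarith)⟩
  · -- `ρ > 0`: `Z₊ = Z₂`, `Z₋ = Z₁`
    refine ⟨Z2, Z1, hF2, hF1, fun z hz hz0 => (sgn (hP2 z hz hz0)).1 (by nlinarith),
      fun z hz hz0 => (sgn (hP1 z hz hz0)).2 (by nlinarith)⟩

end Hermitian

end Literature.AlgebraicGeometry.Motives

end
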